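import Mathlib
import Summits.KontsevichZagierPeriods.Zeta5Search.WedgeDictionaryConsequences
import HarnessLib

/-!
# The wedge-square dictionary: elimination of `ζ(3)` / `ζ(5)` and the approximating forms `Qζ(5) − P`

Cell `pub-zeta5` (HONEST FRAMING: systematic search; no irrationality claim unless certified), typer seat
generation 3.  OUR work (Summit side): the bridge from the dictionary layer (`WedgeDictionary*.lean`) to the
linear forms `q_n ζ(5) − p_n` that the cell's criteria (`Criteria.lean`, `LinearFormCertificate`) and census measure.

UNCONDITIONAL (from the decomposition theorem `vwp_decomposition`, i.e. `F̃₇ = Uζ(5) + Wζ(3) − V` at `b` and at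
the partner `b′ = b + e_j`):

* `zeta3_elimination`:  `W′·F̃₇(b) − W·F̃₇(b′) = (UW′ − U′W)·ζ(5) − (W′V − WV′)` — a two-term form in `1, ζ(5)`;
* `zeta5_elimination`:  `U′·F̃₇(b) − U·F̃₇(b′) = (U′W − UW′)·ζ(3) − (U′V − UV′)` — a two-term form in `1, ζ(3)`.

UNDER THE CONJECTURE (`wedgeDictionary`, as an explicit hypothesis), on its region:

* `approximatingForm_of_wedgeDictionary`:  `Q(a)·ζ(5) − P = ρ·(W′·F̃₇(b) − W·F̃₇(b′))` with the INTEGER `Q(a)` of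
  Brown–Zudilin (17) and `P = ρ(W′V − WV′)` — the shape in which the cellular construction produces rational
  approximations to `ζ(5)` (the `ζ(3)`-free combination of two contiguous very-well-poised series), i.e. the data
  `(q, p) = (Q(a·n), P(a·n))_n` a `LinearFormCertificate (zetaValue 5)` would have to control;
* `abs_approximatingForm_le_of_wedgeDictionary`: hence `|Qζ(5) − P| ≤ |ρ|·(|W′|·|F̃₇(b)| + |W|·|F̃₇(b′)|)`.
-/

noncomputable section

open Finset Polynomial

namespace Summit.KontsevichZagierPeriods.Zeta5Search.WedgeDictionary

open Summit.KontsevichZagierPeriods.Zeta5Search.DualSeries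
open Literature.NumberTheory.Irrationality.BrownZudilin2022 (vwpDual bOfA Converges cellularIntegral QOf)
open Literature.NumberTheory.Transcendental (zetaValue)

/-! ### Elimination identities (unconditional) -/

/-- **`ζ(3)`-ELIMINATION**: for `b` in the box with `d(b) ≥ 0` and a partner `j ∈ [1,7]` with `b_j ≤ b₀`, writing
`b′ = b + e_j`: `W(b′)·F̃₇(b) − W(b)·F̃₇(b′) = (U W′ − U′ W)·ζ(5) − (W′ V − W V′)`. -/
theorem zeta3_elimination (b : ℕ → ℤ) (hb : InBox b) (hd : 0 ≤ dOf b) {j : ℕ} (hj : j ∈ Icc 1 7)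
    (hle : b j ≤ b 0) :
    (coeffW (Function.update b j (b j + 1)) : ℝ) * vwpDual 7 b -
        (coeffW b : ℝ) * vwpDual 7 (Function.update b j (b j + 1)) =
      ((coeffU b * coeffW (Function.update b j (b j + 1)) -
            coeffU (Function.update b j (b j + 1)) * coeffW b : ℚ) : ℝ) * zetaValue 5 -
        ((coeffW (Function.update b j (b j + 1)) * coeffV b -
            coeffW b * coeffV (Function.update b j (b j + 1)) : ℚ) : ℝ) := by
  obtain ⟨i, rfl⟩ : ∃ i, j = i + 1 := ⟨j - 1, by have := (mem_Icc.1 hj).1; omega⟩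
  have hi : i ∈ range 7 := by have := (mem_Icc.1 hj).2; exact mem_range.2 (by omega)
  obtain ⟨hbox', hsum'⟩ := box_update b hb hd hi hle
  rw [(vwp_decomposition b hb (sum_le_of_dOf b hd)).2, (vwp_decomposition _ hbox' hsum').2]
  push_cast
  ring

/-- **`ζ(5)`-ELIMINATION**: with the same hypotheses,
`U(b′)·F̃₇(b) − U(b)·F̃₇(b′) = (U′ W − U W′)·ζ(3) − (U′ V − U V′)`. -/
theorem zeta5_elimination (b : ℕ → ℤ) (hb : InBox b) (hd : 0 ≤ dOf b) {j : ℕ} (hj : j ∈ Icc 1 7)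
    (hle : b j ≤ b 0) :
    (coeffU (Function.update b j (b j + 1)) : ℝ) * vwpDual 7 b -
        (coeffU b : ℝ) * vwpDual 7 (Function.update b j (b j + 1)) =
      ((coeffU (Function.update b j (b j + 1)) * coeffW b -
            coeffU b * coeffW (Function.update b j (b j + 1)) : ℚ) : ℝ) * zetaValue 3 -
        ((coeffU (Function.update b j (b j + 1)) * coeffV b -
            coeffU b * coeffV (Function.update b j (b j + 1)) : ℚ) : ℝ) := by
  obtain ⟨i, rfl⟩ : ∃ i, j = i + 1 := ⟨j - 1, by have := (mem_Icc.1 hj).1; omega⟩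
  have hi : i ∈ range 7 := by have := (mem_Icc.1 hj).2; exact mem_range.2 (by omega)
  obtain ⟨hbox', hsum'⟩ := box_update b hb hd hi hle
  rw [(vwp_decomposition b hb (sum_le_of_dOf b hd)).2, (vwp_decomposition _ hbox' hsum').2]
  push_cast
  ring

/-! ### The approximating forms under the conjecture -/

/-- **THE APPROXIMATING FORM** (under `wedgeDictionary`): for `a` in the region of the conjecture and an admissible
partner `j`, `Q(a)·ζ(5) − P(a) = ρ(a)·(W(b′)·F̃₇(b) − W(b)·F̃₇(b′))` with `P(a) = ρ(W′V − WV′)` — the integer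
leading coefficient `Q(a)` of (17) times `ζ(5)` minus a rational, expressed as the `ζ(3)`-free combination of two
contiguous very-well-poised series. -/
theorem approximatingForm_of_wedgeDictionary (hW : wedgeDictionary) (a : Fin 8 → ℤ) {j : ℕ}
    (hj : j ∈ Icc 1 7) (hconv : Converges a)
    (hreg : ∀ i ∈ Icc 1 7, 0 ≤ bOfA a i ∧ 2 * bOfA a i ≤ bOfA a 0 + 1)
    (hd : 0 ≤ dOf (bOfA a)) (hpart : 2 * (bOfA a j + 1) ≤ bOfA a 0 + 1) :
    (QOf a : ℝ) * zetaValue 5 -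
        ((rhoOf a * (coeffW (Function.update (bOfA a) j (bOfA a j + 1)) * coeffV (bOfA a) -
            coeffW (bOfA a) * coeffV (Function.update (bOfA a) j (bOfA a j + 1))) : ℚ) : ℝ) =
      (rhoOf a : ℝ) * ((coeffW (Function.update (bOfA a) j (bOfA a j + 1)) : ℝ) * vwpDual 7 (bOfA a) -
        (coeffW (bOfA a) : ℝ) * vwpDual 7 (Function.update (bOfA a) j (bOfA a j + 1))) := by
  obtain ⟨hQ, -⟩ := hW a j hj hconv hreg hd hpart
  have hbox := inBox_of_region (bOfA a) hreg hj hpart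
  have hle : bOfA a j ≤ bOfA a 0 := by have := (hreg j hj).1; linarith
  have hQ' : ((QOf a : ℤ) : ℝ) = (rhoOf a : ℝ) * ((coeffU (bOfA a) : ℝ) *
      coeffW (Function.update (bOfA a) j (bOfA a j + 1)) -
        coeffU (Function.update (bOfA a) j (bOfA a j + 1)) * coeffW (bOfA a)) := by
    have h := congrArg (fun q : ℚ => (q : ℝ)) hQ
    push_cast at h
    exact h
  have hE := zeta3_elimination (bOfA a) hbox hd hj hle
  push_cast at hE ⊢
  rw [hQ', mul_sub (rhoOf a : ℝ) ((coeffW (Function.update (bOfA a) j (bOfA a j + 1)) : ℝ) *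
    vwpDual 7 (bOfA a)), ← mul_sub, hE]
  ring

/-- Under the conjecture, the form is SMALL exactly when the two very-well-poised series are:
`|Q(a)ζ(5) − P(a)| ≤ |ρ|·(|W′|·|F̃₇(b)| + |W|·|F̃₇(b′)|)`. -/
theorem abs_approximatingForm_le_of_wedgeDictionary (hW : wedgeDictionary) (a : Fin 8 → ℤ) {j : ℕ}
    (hj : j ∈ Icc 1 7) (hconv : Converges a)
    (hreg : ∀ i ∈ Icc 1 7, 0 ≤ bOfA a i ∧ 2 * bOfA a i ≤ bOfA a 0 + 1)
    (hd : 0 ≤ dOf (bOfA a)) (hpart : 2 * (bOfA a j + 1) ≤ bOfA a 0 + 1) :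
    |(QOf a : ℝ) * zetaValue 5 -
        ((rhoOf a * (coeffW (Function.update (bOfA a) j (bOfA a j + 1)) * coeffV (bOfA a) -
            coeffW (bOfA a) * coeffV (Function.update (bOfA a) j (bOfA a j + 1))) : ℚ) : ℝ)| ≤
      |(rhoOf a : ℝ)| * (|(coeffW (Function.update (bOfA a) j (bOfA a j + 1)) : ℝ)| * |vwpDual 7 (bOfA a)| +
        |(coeffW (bOfA a) : ℝ)| * |vwpDual 7 (Function.update (bOfA a) j (bOfA a j + 1))|) := by
  rw [approximatingForm_of_wedgeDictionary hW a hj hconv hreg hd hpart, abs_mul]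
  gcongr
  exact (abs_sub _ _).trans (by rw [abs_mul, abs_mul])

end Summit.KontsevichZagierPeriods.Zeta5Search.WedgeDictionary
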